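import Literature.Computability.QuantumComplexity.ForrelationMSubspaceDuality
import HarnessLib

/-!
# Coset importance sampling for the SIGNED forrelation of an arbitrary pair

Topic `Literature/Computability/QuantumComplexity` (family `quantum-advantage`; prover seat
`prover-pitem-stmt-QuantumAdvantage-13933-c2-0`, 2026-08-16, support mathematics for item
stmt-QuantumAdvantage-13933 `SignedCubicForrelationInPrBPP` (r7) of route `QuantumAdvantage/CubicForrelation`).
Theorems only (no definitions, no named facts); continues `ForrelationSignTransport.lean` /
`ForrelationMSubspaceDuality.lean` in namespace `DerivativeWalsh` (`W`, `fsum`, `twist`, `signOf`, `bxor`).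

Fix ANY finset `U` of bit vectors and write `U^⊥ = {y : (-1)^{x·y} = 1 ∀ x ∈ U}`. For real `f, g` on `{0,1}ⁿ`
put (these are written out in full in every statement below)

  `A(s,r) = ∑_{u ∈ U} f(s ⊕ u) (-1)^{(s⊕u)·r}`   (character sum of `f` over the coset `s + U`),
  `B(r,s) = ∑_{t ∈ U^⊥} g(r ⊕ t) (-1)^{(r⊕t)·s}`  (character sum of `g` over the coset `r + U^⊥`).

**Main identities** (all proved, for EVERY finset `U`, no subgroup hypothesis):

* `sum_sq_twist_sum`       : `∑_r (∑_{u∈U} (-1)^{u·r} F(u))² = 2ⁿ ∑_{u∈U} F(u)²` (Parseval on `U`);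
* `sum_coset_char_sum_sq`  : `∑_r A(s,r)² = 2ⁿ ∑_{u∈U} f(s⊕u)²` for every `s`, hence
  `sum_sum_coset_char_sum_sq` : `∑_{s,r} A(s,r)² = 2ⁿ |U| ∑_x f(x)²`;
* `sum_twist_mul_coset_char_sums` (the MATCHED-COSET IDENTITY):
  `∑_{s,r} (-1)^{s·r} A(s,r) B(r,s) = |U| · |U^⊥| · S(f,g)`,  `S(f,g) = ∑_{x,y} f(x)(-1)^{x·y} g(y) = 2^{3n/2} Φ`.

**The estimator** (Boolean `a, b` read through `signOf`, `U ∋ 0` closed under `⊕`, so `|U||U^⊥| = 2ⁿ`):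
with the probability weights `p(s,r) = A(s,r)² / (4ⁿ |U|)` and the values
`Y(s,r) = |U| (-1)^{s·r} B(r,s) / (√(2ⁿ) A(s,r))` (read as `0` when `A(s,r) = 0`, where `p = 0` anyway),

* `coset_weights_nonneg`, `sum_coset_weights` (`∑ p = 1`), `sum_coset_weights_row` (`∑_r p(s,r) = 2⁻ⁿ`:
  the `s`-marginal is UNIFORM),
* `sum_coset_weights_mul` : `∑_{s,r} p·Y = Φ(a,b)`      (unbiased for the SIGNED value),
* `sum_coset_weights_mul_sq` : `∑_{s,r} p·Y² ≤ 1`       (unit second moment),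

packaged as `forrelation_coset_importance_sampling`. So for EVERY pair `(a,b)` and EVERY subgroup `U` the
signed forrelation is the mean of a random variable of second moment `≤ 1`; `N = ⌈100/ε²⌉` i.i.d. rounds give
`Φ ± ε` with probability `≥ 99/100` (Chebyshev) — provided one can SAMPLE `(s,r) ∼ p` and EVALUATE `Y`.

## Why it matters (prose; the complexity statement is NOT formalised here)

Call `U` *bi-isotropic* for a CUBIC pair `(a,b)` when `a` has 𝔽₂-degree `≤ 2` on every coset of `U` and `b`
has degree `≤ 2` on every coset of `U^⊥` (third differences of `a` along `U`, of `b` along `U^⊥`, vanish —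
`O(n³)` coefficient checks). Then every `A(s,·)²` is `|U|²/2^{ρ_s}` on an explicit affine subspace of
characters and `0` elsewhere (Dickson), so `s` uniform + one linear solve samples `p` exactly, and `A(s,r)`,
`B(r,s)` are quadratic Gauss sums over `𝔽₂` — exact, signed, polynomial time. Consequently

  *signed* 2-fold Forrelation of a cubic pair, to additive accuracy `ε`, costs `poly(n)/ε²` classical time
  GIVEN a bi-isotropic `U` — for ANY value of `Φ`, any dimension of `U`, with no exactness (`Φ = ±1`:
  `ForrelationSignTransport.lean`), no affineness / half-dimensionality of an M-subspace (the one-sided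
  matched sum of the r7 line `polar-radical-seeds`, whose cost grows like `4^{defect}`), and no defect penalty.

For the 3/5-promise of r7 (`signedCubicForrelationProblem 2`: YES `Φ ≥ 3/5`, NO `Φ ≤ -3/5`) this puts the whole
band `3/5 ≤ |Φ| < 1` on the same footing as the exact slice: the problem reduces to FINDING a bi-isotropic
subspace of the pair of cubic coefficient tensors (certifiable in `O(n³)`), and the line's residue is exactly
the set of in-promise pairs without (findable) bi-isotropic structure. Every exactly forrelated pair with an
M-subspace `V` of `b` (take `U = V^⊥`; `dual_affine_on_perp_cosets`) — in particular every Maiorana–McFarland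
pair —, every direct sum of such a pair with the sporadic odd blocks on file (the `P₄` witness
`x₁x₂x₃ ↔ [wt = 2]`, `Φ = 625/1024`: `U = ⟨e₁⟩` per block), and every quadratic pair (`U = 0` or `U = 𝔽₂ⁿ`)
is bi-isotropic. Sampling the `a`-side term instead of summing it (weights `∝ B²`, one uniform `u ∈ U` per
round) gives the ONE-sided estimator, of second moment `#{(s,r) : B(r,s) ≠ 0} / (2ⁿ|U^⊥|)`, which is
`2ⁿ/|U^⊥|² = 4^{defect}` when `b` is affine on the cosets of `U^⊥` — the matched-sum law already used by the
r7 line; it is not repeated here. Deliberately NOT here: `Submodule (ZMod 2)` language, the Gauss-sum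
evaluation, the sampler as an `FP`/coin machine, any `PromiseBPP'` statement.

## References

* [AaronsonAmbainis2018] S. Aaronson, A. Ambainis, Forrelation, SIAM J. Comput. 47 (2018), §1.1.1 (`Φ`).
* [ODonnell2014] R. O'Donnell, Analysis of Boolean Functions (2014), §1.4 (characters, Parseval), §3.3
  (restrictions to cosets / Poisson summation).
* E. Tang, A quantum-inspired classical algorithm for recommendation systems, STOC 2019 (length-squared /
  importance sampling of inner products) — orientation for the estimator, as in `ForrelationDerivativeTables.lean`.
-/

noncomputable section

namespace Literature.Computability.QuantumComplexity

namespace DerivativeWalsh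

open Finset
open Literature.Computability.QuantumComplexity.BuzetChailloux
open Literature.Computability.QuantumComplexity.Simon (twist_mul_self twist_sq twist_eq_one_or sum_twist)

variable {n : ℕ}

/-! ### Bit-vector and character bookkeeping -/

/-- `(s ⊕ u) ⊕ (s ⊕ u') = u ⊕ u'`. [folklore] -/
theorem bxor_bxor_bxor_cancel (s u u' : Fin n → Bool) : bxor (bxor s u) (bxor s u') = bxor u u' := by
  funext i
  simp only [bxor]
  cases s i <;> cases u i <;> cases u' i <;> rfl

/-- The phase bookkeeping of the matched-coset identity: if `(-1)^{u·t} = 1` then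
`(-1)^{s·r} (-1)^{(s⊕u)·r} (-1)^{(r⊕t)·s} = (-1)^{(s⊕u)·(r⊕t)}`. [cite: ODonnell2014, §1.4] -/
theorem twist_phase_of_twist_eq_one {u t : Fin n → Bool} (hut : twist u t = 1) (s r : Fin n → Bool) :
    twist s r * twist (bxor s u) r * twist (bxor r t) s = twist (bxor s u) (bxor r t) := by
  rw [twist_bxor_right (bxor s u) r t, twist_bxor_left s u r, twist_bxor_left s u t,
    twist_bxor_left r t s, hut, twist_comm r s, twist_comm t s]
  linear_combination (twist s r * twist u r * twist s t) * twist_mul_self s r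

/-- Translating both variables of the double sum `S(f,g)`: for `(-1)^{u·t} = 1`,
`∑_{s,r} (-1)^{s·r} f(s⊕u)(-1)^{(s⊕u)·r} · g(r⊕t)(-1)^{(r⊕t)·s} = S(f,g)`. [cite: ODonnell2014, §1.4] -/
theorem sum_sum_shift_eq_fsum (f g : (Fin n → Bool) → ℝ) {u t : Fin n → Bool} (hut : twist u t = 1) :
    ∑ s : Fin n → Bool, ∑ r : Fin n → Bool,
        twist s r * (f (bxor s u) * twist (bxor s u) r) * (g (bxor r t) * twist (bxor r t) s) =
      fsum f g := by
  have e1 : ∀ s r : Fin n → Bool,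
      twist s r * (f (bxor s u) * twist (bxor s u) r) * (g (bxor r t) * twist (bxor r t) s) =
        f (bxor u s) * twist (bxor u s) (bxor t r) * g (bxor t r) := by
    intro s r
    rw [bxor_comm u s, bxor_comm t r, ← twist_phase_of_twist_eq_one hut s r]
    ring
  simp_rw [e1]
  have e2 : ∀ s : Fin n → Bool,
      ∑ r, f (bxor u s) * twist (bxor u s) (bxor t r) * g (bxor t r) =
        ∑ y, f (bxor u s) * twist (bxor u s) y * g y := fun s =>
    Equiv.sum_comp (bxorPerm t) (fun y => f (bxor u s) * twist (bxor u s) y * g y)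
  simp_rw [e2]
  exact Equiv.sum_comp (bxorPerm u) (fun x => ∑ y, f x * twist x y * g y)

/-! ### Parseval on a finset and on its cosets -/

/-- **Parseval on a finset**: `∑_r (∑_{u ∈ U} (-1)^{u·r} F(u))² = 2ⁿ ∑_{u ∈ U} F(u)²` for every finset `U`
of bit vectors and every real `F` (orthogonality of characters). [cite: ODonnell2014, §1.4] -/
theorem sum_sq_twist_sum (F : (Fin n → Bool) → ℝ) (U : Finset (Fin n → Bool)) :
    ∑ r : Fin n → Bool, (∑ u ∈ U, twist u r * F u) ^ 2 = (2 : ℝ) ^ n * ∑ u ∈ U, F u ^ 2 := by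
  have e1 : ∀ r : Fin n → Bool, (∑ u ∈ U, twist u r * F u) ^ 2 =
      ∑ u ∈ U, ∑ u' ∈ U, F u * F u' * twist (bxor u u') r := by
    intro r
    rw [sq, sum_mul_sum]
    refine sum_congr rfl fun u _ => sum_congr rfl fun u' _ => ?_
    rw [twist_bxor_left]
    ring
  rw [sum_congr rfl fun r _ => e1 r, sum_comm]
  have e2 : ∀ u ∈ U, ∑ r, ∑ u' ∈ U, F u * F u' * twist (bxor u u') r = (2 : ℝ) ^ n * F u ^ 2 := by
    intro u hu
    rw [sum_comm]
    have e3 : ∀ u' ∈ U, ∑ r, F u * F u' * twist (bxor u u') r =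
        F u * F u' * (if bxor u u' = zeroVec then (2 : ℝ) ^ n else 0) := by
      intro u' _
      rw [← mul_sum]
      congr 1
      exact sum_twist _
    rw [sum_congr rfl e3]
    simp_rw [bxor_eq_zeroVec_iff, mul_ite, mul_zero]
    rw [Finset.sum_ite_eq U u, if_pos hu]
    ring
  rw [sum_congr rfl e2, ← mul_sum]

/-- **Parseval on a coset**: `∑_r A(s,r)² = 2ⁿ ∑_{u ∈ U} f(s⊕u)²` for the character sums
`A(s,r) = ∑_{u∈U} f(s⊕u)(-1)^{(s⊕u)·r}` of `f` over the coset `s + U` (any finset `U`, any `s`).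
[cite: ODonnell2014, §3.3] -/
theorem sum_coset_char_sum_sq (f : (Fin n → Bool) → ℝ) (U : Finset (Fin n → Bool)) (s : Fin n → Bool) :
    ∑ r : Fin n → Bool, (∑ u ∈ U, f (bxor s u) * twist (bxor s u) r) ^ 2 =
      (2 : ℝ) ^ n * ∑ u ∈ U, f (bxor s u) ^ 2 := by
  have e1 : ∀ r : Fin n → Bool, ∑ u ∈ U, f (bxor s u) * twist (bxor s u) r =
      twist s r * ∑ u ∈ U, twist u r * f (bxor s u) := by
    intro r
    rw [mul_sum]
    refine sum_congr rfl fun u _ => ?_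
    rw [twist_bxor_left]
    ring
  simp_rw [e1, mul_pow, twist_sq, one_mul]
  exact sum_sq_twist_sum (fun u => f (bxor s u)) U

/-- **Total mass of the coset character sums**: `∑_{s,r} A(s,r)² = 2ⁿ · |U| · ∑_x f(x)²` (any finset `U`).
[cite: ODonnell2014, §3.3] -/
theorem sum_sum_coset_char_sum_sq (f : (Fin n → Bool) → ℝ) (U : Finset (Fin n → Bool)) :
    ∑ s : Fin n → Bool, ∑ r : Fin n → Bool, (∑ u ∈ U, f (bxor s u) * twist (bxor s u) r) ^ 2 =
      (2 : ℝ) ^ n * U.card * ∑ x, f x ^ 2 := by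
  simp_rw [sum_coset_char_sum_sq, ← mul_sum]
  rw [sum_comm]
  have e : ∀ u ∈ U, ∑ s : Fin n → Bool, f (bxor s u) ^ 2 = ∑ x, f x ^ 2 := by
    intro u _
    have := Equiv.sum_comp (bxorPerm u) (fun x => f x ^ 2)
    simp_rw [bxorPerm_apply] at this
    rw [← this]
    exact sum_congr rfl fun s _ => by rw [bxor_comm]
  rw [sum_congr rfl e, sum_const, nsmul_eq_mul, mul_assoc]

/-! ### The matched-coset identity -/

/-- **Matched-coset identity**: for EVERY finset `U` of bit vectors, with `U^⊥ = {y : (-1)^{x·y} = 1 ∀ x ∈ U}`,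
`∑_{s,r} (-1)^{s·r} A(s,r) B(r,s) = |U| · |U^⊥| · S(f,g)`, where `A(s,r) = ∑_{u∈U} f(s⊕u)(-1)^{(s⊕u)·r}` and
`B(r,s) = ∑_{t∈U^⊥} g(r⊕t)(-1)^{(r⊕t)·s}` (expand, use `(-1)^{u·t} = 1`, translate both variables).
For `U = {0}` this is `S = ∑_s f(s) W_g(s)`; for exactly forrelated `±1` pairs each term already carries the
sign of `S` (`sign_transport`). [cite: ODonnell2014, §3.3] -/
theorem sum_twist_mul_coset_char_sums (f g : (Fin n → Bool) → ℝ) (U : Finset (Fin n → Bool)) :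
    ∑ s : Fin n → Bool, ∑ r : Fin n → Bool,
        twist s r * (∑ u ∈ U, f (bxor s u) * twist (bxor s u) r) *
          (∑ t ∈ univ.filter (fun y => ∀ x ∈ U, twist x y = 1), g (bxor r t) * twist (bxor r t) s) =
      (U.card : ℝ) * (univ.filter (fun y => ∀ x ∈ U, twist x y = 1)).card * fsum f g := by
  set P : Finset (Fin n → Bool) := univ.filter (fun y => ∀ x ∈ U, twist x y = 1) with hP
  have step1 : ∀ s r : Fin n → Bool,
      twist s r * (∑ u ∈ U, f (bxor s u) * twist (bxor s u) r) *
          (∑ t ∈ P, g (bxor r t) * twist (bxor r t) s) =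
        ∑ u ∈ U, ∑ t ∈ P,
          twist s r * (f (bxor s u) * twist (bxor s u) r) * (g (bxor r t) * twist (bxor r t) s) := by
    intro s r
    rw [Finset.mul_sum U, Finset.sum_mul_sum]
  simp_rw [step1]
  have step2 : ∀ s : Fin n → Bool,
      ∑ r : Fin n → Bool, ∑ u ∈ U, ∑ t ∈ P,
          twist s r * (f (bxor s u) * twist (bxor s u) r) * (g (bxor r t) * twist (bxor r t) s) =
        ∑ u ∈ U, ∑ t ∈ P, ∑ r : Fin n → Bool,
          twist s r * (f (bxor s u) * twist (bxor s u) r) * (g (bxor r t) * twist (bxor r t) s) := by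
    intro s
    rw [sum_comm]
    exact sum_congr rfl fun u _ => sum_comm
  simp_rw [step2]
  rw [sum_comm]
  have step3 : ∀ u ∈ U,
      ∑ s : Fin n → Bool, ∑ t ∈ P, ∑ r : Fin n → Bool,
          twist s r * (f (bxor s u) * twist (bxor s u) r) * (g (bxor r t) * twist (bxor r t) s) =
        (P.card : ℝ) * fsum f g := by
    intro u hu
    rw [sum_comm]
    have : ∀ t ∈ P, ∑ s : Fin n → Bool, ∑ r : Fin n → Bool,
        twist s r * (f (bxor s u) * twist (bxor s u) r) * (g (bxor r t) * twist (bxor r t) s) =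
          fsum f g := by
      intro t ht
      exact sum_sum_shift_eq_fsum f g ((mem_filter.1 ht).2 u hu)
    rw [sum_congr rfl this, sum_const, nsmul_eq_mul]
  rw [sum_congr rfl step3, sum_const, nsmul_eq_mul, mul_assoc]

/-! ### The importance-sampling estimator for Boolean pairs -/

/-- `∑_x (-1)^{2 a(x)} = 2ⁿ`. [folklore] -/
theorem sum_signOf_sq (a : (Fin n → Bool) → Bool) : ∑ x : Fin n → Bool, signOf (a x) ^ 2 = (2 : ℝ) ^ n := by
  simp_rw [signOf_sq, sum_const, card_univ, Fintype.card_fun, Fintype.card_bool, Fintype.card_fin,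
    nsmul_eq_mul, mul_one]
  push_cast
  rfl

/-- The weights `p(s,r) = A(s,r)²/(4ⁿ|U|)` are non-negative. [folklore] -/
theorem coset_weights_nonneg (a : (Fin n → Bool) → Bool) (U : Finset (Fin n → Bool)) (s r : Fin n → Bool) :
    0 ≤ (∑ u ∈ U, signOf (a (bxor s u)) * twist (bxor s u) r) ^ 2 / ((4 : ℝ) ^ n * U.card) := by
  positivity

/-- Row sums of the weights: `∑_r p(s,r) = 2⁻ⁿ` for every `s` and every NON-EMPTY finset `U` — the
`s`-marginal of `p` is uniform. [cite: ODonnell2014, §3.3] -/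
theorem sum_coset_weights_row (a : (Fin n → Bool) → Bool) {U : Finset (Fin n → Bool)} (hU : U.Nonempty)
    (s : Fin n → Bool) :
    ∑ r : Fin n → Bool, (∑ u ∈ U, signOf (a (bxor s u)) * twist (bxor s u) r) ^ 2 / ((4 : ℝ) ^ n * U.card) =
      ((2 : ℝ) ^ n)⁻¹ := by
  rw [← sum_div, sum_coset_char_sum_sq (fun x => signOf (a x)) U s]
  simp_rw [signOf_sq, sum_const, nsmul_eq_mul, mul_one]
  have hc : (0 : ℝ) < U.card := by exact_mod_cast hU.card_pos
  have h4 : (4 : ℝ) ^ n = 2 ^ n * 2 ^ n := by rw [← mul_pow]; norm_num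
  rw [h4]
  field_simp

/-- Total mass: `∑_{s,r} p(s,r) = 1` for every non-empty finset `U`. [cite: ODonnell2014, §3.3] -/
theorem sum_coset_weights (a : (Fin n → Bool) → Bool) {U : Finset (Fin n → Bool)} (hU : U.Nonempty) :
    ∑ s : Fin n → Bool, ∑ r : Fin n → Bool,
        (∑ u ∈ U, signOf (a (bxor s u)) * twist (bxor s u) r) ^ 2 / ((4 : ℝ) ^ n * U.card) = 1 := by
  simp_rw [sum_coset_weights_row a hU, sum_const, card_univ, Fintype.card_fun, Fintype.card_bool,
    Fintype.card_fin, nsmul_eq_mul]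
  push_cast
  have h2 : (0 : ℝ) < (2 : ℝ) ^ n := by positivity
  field_simp

/-- **Unbiasedness**: `∑_{s,r} p(s,r) · Y(s,r) = Φ(a,b)` for `U ∋ 0` closed under `⊕`, with
`p = A²/(4ⁿ|U|)` and `Y = |U| (-1)^{s·r} B(r,s) / (√(2ⁿ) A(s,r))` (`Y` reads `0` where `A = 0`, and there
`p = 0`): termwise `p·Y = (-1)^{s·r} A B / (4ⁿ √(2ⁿ))`, then the matched-coset identity and `|U||U^⊥| = 2ⁿ`.
[cite: AaronsonAmbainis2018, §1.1.1] -/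
theorem sum_coset_weights_mul (a b : (Fin n → Bool) → Bool) {U : Finset (Fin n → Bool)}
    (h0 : zeroVec ∈ U) (hadd : ∀ x ∈ U, ∀ y ∈ U, bxor x y ∈ U) :
    ∑ s : Fin n → Bool, ∑ r : Fin n → Bool,
        ((∑ u ∈ U, signOf (a (bxor s u)) * twist (bxor s u) r) ^ 2 / ((4 : ℝ) ^ n * U.card)) *
          ((U.card : ℝ) * twist s r *
              (∑ t ∈ univ.filter (fun y => ∀ x ∈ U, twist x y = 1),
                signOf (b (bxor r t)) * twist (bxor r t) s) /
            (Real.sqrt ((2 : ℝ) ^ n) * ∑ u ∈ U, signOf (a (bxor s u)) * twist (bxor s u) r)) =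
      forrelation a b := by
  -- instantiate the real-valued identities BEFORE abbreviating `U^⊥` as `P`
  have key := sum_twist_mul_coset_char_sums (fun x => signOf (a x)) (fun y => signOf (b y)) U
  beta_reduce at key
  have hUP := card_mul_card_perp h0 hadd
  set P : Finset (Fin n → Bool) := univ.filter (fun y => ∀ x ∈ U, twist x y = 1) with hP
  have hc : (0 : ℝ) < U.card := by exact_mod_cast card_pos.2 ⟨_, h0⟩
  have hsq : (0 : ℝ) < Real.sqrt ((2 : ℝ) ^ n) := Real.sqrt_pos.2 (by positivity)
  have h4 : (0 : ℝ) < (4 : ℝ) ^ n := by positivity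
  -- termwise simplification
  have e1 : ∀ s r : Fin n → Bool,
      ((∑ u ∈ U, signOf (a (bxor s u)) * twist (bxor s u) r) ^ 2 / ((4 : ℝ) ^ n * U.card)) *
          ((U.card : ℝ) * twist s r * (∑ t ∈ P, signOf (b (bxor r t)) * twist (bxor r t) s) /
            (Real.sqrt ((2 : ℝ) ^ n) * ∑ u ∈ U, signOf (a (bxor s u)) * twist (bxor s u) r)) =
        ((4 : ℝ) ^ n * Real.sqrt ((2 : ℝ) ^ n))⁻¹ *
          (twist s r * (∑ u ∈ U, signOf (a (bxor s u)) * twist (bxor s u) r) *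
            (∑ t ∈ P, signOf (b (bxor r t)) * twist (bxor r t) s)) := by
    intro s r
    by_cases hA : ∑ u ∈ U, signOf (a (bxor s u)) * twist (bxor s u) r = 0
    · simp [hA]
    · field_simp
  simp_rw [e1]
  simp_rw [← Finset.mul_sum]
  rw [key, fsum_signOf_eq, sqrt_two_pow_three_mul]
  have h4' : (4 : ℝ) ^ n = 2 ^ n * 2 ^ n := by rw [← mul_pow]; norm_num
  rw [show (U.card : ℝ) * (P.card : ℝ) * ((2 : ℝ) ^ n * Real.sqrt ((2 : ℝ) ^ n) * forrelation a b) =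
      ((U.card : ℝ) * P.card) * ((2 : ℝ) ^ n * Real.sqrt ((2 : ℝ) ^ n) * forrelation a b) by ring, hUP, h4']
  field_simp

/-- **Unit second moment**: `∑_{s,r} p(s,r) · Y(s,r)² ≤ 1` for `U ∋ 0` closed under `⊕` (termwise
`p·Y² ≤ |U| B(r,s)²/8ⁿ`, then Parseval on the cosets of `U^⊥` and `|U||U^⊥| = 2ⁿ`; equality iff no `A(s,r)`
vanishes where `B(r,s) ≠ 0`). [cite: ODonnell2014, §3.3] -/
theorem sum_coset_weights_mul_sq (a b : (Fin n → Bool) → Bool) {U : Finset (Fin n → Bool)}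
    (h0 : zeroVec ∈ U) (hadd : ∀ x ∈ U, ∀ y ∈ U, bxor x y ∈ U) :
    ∑ s : Fin n → Bool, ∑ r : Fin n → Bool,
        ((∑ u ∈ U, signOf (a (bxor s u)) * twist (bxor s u) r) ^ 2 / ((4 : ℝ) ^ n * U.card)) *
          ((U.card : ℝ) * twist s r *
              (∑ t ∈ univ.filter (fun y => ∀ x ∈ U, twist x y = 1),
                signOf (b (bxor r t)) * twist (bxor r t) s) /
            (Real.sqrt ((2 : ℝ) ^ n) * ∑ u ∈ U, signOf (a (bxor s u)) * twist (bxor s u) r)) ^ 2 ≤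
      1 := by
  -- instantiate the real-valued identities BEFORE abbreviating `U^⊥` as `P`
  have key2 := sum_sum_coset_char_sum_sq (fun y => signOf (b y))
    (univ.filter (fun y => ∀ x ∈ U, twist x y = 1))
  beta_reduce at key2
  have hUP := card_mul_card_perp h0 hadd
  set P : Finset (Fin n → Bool) := univ.filter (fun y => ∀ x ∈ U, twist x y = 1) with hP
  have hc : (0 : ℝ) < U.card := by exact_mod_cast card_pos.2 ⟨_, h0⟩
  have hsq : (0 : ℝ) < Real.sqrt ((2 : ℝ) ^ n) := Real.sqrt_pos.2 (by positivity)
  have hsq2 : Real.sqrt ((2 : ℝ) ^ n) ^ 2 = (2 : ℝ) ^ n := Real.sq_sqrt (by positivity)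
  have h4 : (0 : ℝ) < (4 : ℝ) ^ n := by positivity
  have h8 : (8 : ℝ) ^ n = 4 ^ n * 2 ^ n := by rw [← mul_pow]; norm_num
  -- termwise bound `p Y² ≤ |U| B² / 8ⁿ`
  have e1 : ∀ s r : Fin n → Bool,
      ((∑ u ∈ U, signOf (a (bxor s u)) * twist (bxor s u) r) ^ 2 / ((4 : ℝ) ^ n * U.card)) *
          ((U.card : ℝ) * twist s r * (∑ t ∈ P, signOf (b (bxor r t)) * twist (bxor r t) s) /
            (Real.sqrt ((2 : ℝ) ^ n) * ∑ u ∈ U, signOf (a (bxor s u)) * twist (bxor s u) r)) ^ 2 ≤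
        (U.card : ℝ) / (8 : ℝ) ^ n * (∑ t ∈ P, signOf (b (bxor r t)) * twist (bxor r t) s) ^ 2 := by
    intro s r
    by_cases hA : ∑ u ∈ U, signOf (a (bxor s u)) * twist (bxor s u) r = 0
    · rw [hA]
      simp only [mul_zero, div_zero, zero_pow (two_ne_zero), zero_div]
      positivity
    · have heq : ((∑ u ∈ U, signOf (a (bxor s u)) * twist (bxor s u) r) ^ 2 / ((4 : ℝ) ^ n * U.card)) *
          ((U.card : ℝ) * twist s r * (∑ t ∈ P, signOf (b (bxor r t)) * twist (bxor r t) s) /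
            (Real.sqrt ((2 : ℝ) ^ n) * ∑ u ∈ U, signOf (a (bxor s u)) * twist (bxor s u) r)) ^ 2 =
          (U.card : ℝ) / (8 : ℝ) ^ n * (∑ t ∈ P, signOf (b (bxor r t)) * twist (bxor r t) s) ^ 2 := by
        rw [h8]
        field_simp
        rw [twist_sq, hsq2]
        ring
      rw [heq]
  refine (sum_le_sum fun s _ => sum_le_sum fun r _ => e1 s r).trans ?_
  simp_rw [← Finset.mul_sum]
  rw [sum_comm, key2, sum_signOf_sq]
  rw [show (U.card : ℝ) / (8 : ℝ) ^ n * ((2 : ℝ) ^ n * P.card * (2 : ℝ) ^ n) =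
      ((U.card : ℝ) * P.card) * ((2 : ℝ) ^ n * (2 : ℝ) ^ n) / (8 : ℝ) ^ n by ring, hUP,
    show (2 : ℝ) ^ n * ((2 : ℝ) ^ n * (2 : ℝ) ^ n) = (8 : ℝ) ^ n by rw [← mul_pow, ← mul_pow]; norm_num,
    div_self (by positivity)]

/-- **Coset importance sampling for the signed forrelation** (summary). For Boolean `a, b` on `n` bits and
every finset `U ∋ 0` of bit vectors closed under `⊕`, the weights `p(s,r) = A(s,r)²/(4ⁿ|U|)` form a
probability distribution on pairs `(s,r)` with uniform `s`-marginal, and the values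
`Y(s,r) = |U|(-1)^{s·r}B(r,s)/(√(2ⁿ)A(s,r))` satisfy `𝔼_p Y = Φ(a,b)` and `𝔼_p Y² ≤ 1`; here
`A(s,r) = ∑_{u∈U} (-1)^{a(s⊕u)+(s⊕u)·r}`, `B(r,s) = ∑_{t∈U^⊥} (-1)^{b(r⊕t)+(r⊕t)·s}`. When `a` is quadratic
on the cosets of `U` and `b` on the cosets of `U^⊥` (a bi-isotropic `U` of a cubic pair) `p` is exactly
samplable and `Y` exactly computable in polynomial time, so the SIGNED value `Φ(a,b) ± ε` is classical in
`poly(n)/ε²` for every such pair, exact or not. [cite: AaronsonAmbainis2018, §1.1.1] -/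
theorem forrelation_coset_importance_sampling (a b : (Fin n → Bool) → Bool) {U : Finset (Fin n → Bool)}
    (h0 : zeroVec ∈ U) (hadd : ∀ x ∈ U, ∀ y ∈ U, bxor x y ∈ U) :
    (∀ s r : Fin n → Bool,
        0 ≤ (∑ u ∈ U, signOf (a (bxor s u)) * twist (bxor s u) r) ^ 2 / ((4 : ℝ) ^ n * U.card)) ∧
    (∀ s : Fin n → Bool, ∑ r : Fin n → Bool,
        (∑ u ∈ U, signOf (a (bxor s u)) * twist (bxor s u) r) ^ 2 / ((4 : ℝ) ^ n * U.card) =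
          ((2 : ℝ) ^ n)⁻¹) ∧
    (∑ s : Fin n → Bool, ∑ r : Fin n → Bool,
        (∑ u ∈ U, signOf (a (bxor s u)) * twist (bxor s u) r) ^ 2 / ((4 : ℝ) ^ n * U.card) = 1) ∧
    (∑ s : Fin n → Bool, ∑ r : Fin n → Bool,
        ((∑ u ∈ U, signOf (a (bxor s u)) * twist (bxor s u) r) ^ 2 / ((4 : ℝ) ^ n * U.card)) *
          ((U.card : ℝ) * twist s r *
              (∑ t ∈ univ.filter (fun y => ∀ x ∈ U, twist x y = 1),
                signOf (b (bxor r t)) * twist (bxor r t) s) /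
            (Real.sqrt ((2 : ℝ) ^ n) * ∑ u ∈ U, signOf (a (bxor s u)) * twist (bxor s u) r)) =
      forrelation a b) ∧
    (∑ s : Fin n → Bool, ∑ r : Fin n → Bool,
        ((∑ u ∈ U, signOf (a (bxor s u)) * twist (bxor s u) r) ^ 2 / ((4 : ℝ) ^ n * U.card)) *
          ((U.card : ℝ) * twist s r *
              (∑ t ∈ univ.filter (fun y => ∀ x ∈ U, twist x y = 1),
                signOf (b (bxor r t)) * twist (bxor r t) s) /
            (Real.sqrt ((2 : ℝ) ^ n) * ∑ u ∈ U, signOf (a (bxor s u)) * twist (bxor s u) r)) ^ 2 ≤ 1) :=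
  ⟨coset_weights_nonneg a U, sum_coset_weights_row a ⟨_, h0⟩, sum_coset_weights a ⟨_, h0⟩,
    sum_coset_weights_mul a b h0 hadd, sum_coset_weights_mul_sq a b h0 hadd⟩

end DerivativeWalsh

end Literature.Computability.QuantumComplexity

end
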